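import Summits.QuantumAdvantage.AdviceFreeQNC0.WindowLocalHard
import Summits.QuantumAdvantage.AdviceFreeQNC0.ChargeRecursion
import Summits.QuantumAdvantage.AdviceFreeQNC0.PredHard
import Summits.QuantumAdvantage.QuantumAdvantage.Theorems.CharDialUnreadTwist
import Mathlib.Analysis.SpecialFunctions.Complex.CircleAddChar
import Mathlib.NumberTheory.LegendreSymbol.AddCharacter
import Mathlib.Analysis.Normed.Ring.Finite
import HarnessLib

/-!
# CharDial / SliceDial R1w PROVED — «polylog WINDOW ⊕ global counter» strategies lose the u-walk game (`p ≥ 5` prime)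

decomp-qadv lens-6 («barrier-complement carving») g11, rev 5 tree part 14 (supports `stmt-QuantumAdvantage-27049` =
`CharDial.RankOneHardJLinOdd`, equally `stmt-QuantumAdvantage-32604` = `CharDial.WalkHardFJLinOdd`).  Prop-free, sorry-free.
SUPERSEDES part 13
(`CharDialOwnBitRung.lean`, R1a): R1a is the window-`1` (`C = 0`) case of this file's main theorem (`ownBitCounter_hard`, §E).

## Main theorem (`windowCounter_hard`)

For every prime `p ≥ 5` there is ONE `θ < 1` such that for every `C`, for all large `n`, every charge `c` and every
class-indexed family `Y : ZMod p → strategy` whose members are WINDOW-LOCAL at width `(log₂ n)^C` (cut `g` of `Y s` reads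
only the bits `[g - ℓ, g + ℓ - 1]`, `ℓ = (log₂ n)^C`, the tree's `WindowLocal`), the COUNTER-DIAL strategy
`u ↦ Y_{wt u mod p}(·, u)` (`counterStrat`: every cut additionally reads the global counter `wt u mod p` through arbitrary
tables) wins α's u-walk game (`ringWinU`) on at most `θ · 2ⁿ` inputs.  In the presentation class of 32604 (junta ⊕ linear
form over `𝔽_p`) this is the rank-one common dense direction `𝟙` with INTERVAL juntas of any polylog width — it contains
R1a (own bit = window `1`) and lies outside every previously proved rung (`WindowLocalHardU`: the counter is global;
`FinState`/R11/`LinTestsOdd`: the window bits are not functions of prefix counts).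

## Proof

COUNTER-DIAL FOURIER REDUCTION (`counter_reduction`, generic in the class `good`): with the standard additive character `ψ`
of `ZMod p`, `p · #{wt ≡ s, WIN_y} = #WIN_y + Σ_{t ≠ 0} ψ(-ts) A_t(y)`, `A_t(y) = Σ_u [WIN_y u] ψ(t)^{wt u}`
(`class_count_le_twist`); so a class that loses with rate `θ₀` (`h1`, here the tree's `windowLocalHardU`) and has
`A_t = o(2ⁿ)` uniformly (`h2`) yields counter-dial strategies losing with rate `(1 + θ₀)/2`.
`h2` FOR WINDOW STRATEGIES (`window_twist_small`): `[WIN] = (1 - ∏_g sgn_g)/2` (`win_indicator`); on the class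
`wt ≡ w (mod 3)` the sign of cut `g` is EMITTED AT TIME `k = g + ℓ - 1` by a sign table `Etab` reading the REGISTER of the
last `2ℓ` bits and the prefix count `mod 3` (the exponent `c + g + wt u + wtPrefix u g` is recovered as
`c + g + w + P_k + 2·ones(register.take (ℓ-1)) (mod 3)`), the last `ℓ` cuts by a final factor `ftab`
(`sign_split_window`, §C); removing the `mod 3` condition with the characters of `ZMod 3` (`three_mul_classSum`) leaves
REGISTER TRANSFER sums `GG(μ) = Σ_v μ^{wt v} ∏_j sgn(E_j(register_j, v_j, P_j)) Φ(register_n, P_n)`, `μ = ψ_p(t)ψ₃(r)`,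
`μ⁶ ≠ 1`.  §B bounds them for ANY `W`-local 3-periodic sign table: over a block of `W + 3` bits the continuations
`000·s` and `111·s` (`s ∈ {0,1}^W`) end on registers with the same top `W` cells and on prefix counts differing by `3`,
with twist ratio `μ³` and REAL signs, so `‖GG_{W+3}‖ ≤ 2^W (6 + β) ‖Φ‖` with `β = max ‖1 ± μ³‖ < 2`
(`norm_GG_block_le`, `beta_lt_two`), whence `‖GG_n‖ ≤ 2ⁿ κ^{⌊n/(W+3)⌋}`, `κ = (6+β)/8 < 1` (`norm_GG_le_kappa`) and
`‖A_t‖ ≤ 2 · 2ⁿ κ^{⌊n/(2ℓ+3)⌋} = o(2ⁿ)` as long as `ℓ = o(n)` — for `ℓ = (log₂ n)^C` by the tree's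
`DWalk.const_mul_logPow_le'`.

## §E: R1a as a corollary; reach

`ownBitCounter_hard` (R1a = part 13's `obc_hard`) is the case `C = 0`.  The generic `counter_reduction` also gives
«`log₂ n`-juntas at ARBITRARY positions ⊕ the counter» from the tree's `walkHardFJuntaCuts` PLUS one estimate the
register transfer does not supply (`A_t = o(2ⁿ)` for log-junta strategies: a junta bit read far in the past is never
flushed from the register) — recorded as the typed open rung R1b / `TwistedJuntaBias` in the lens-6 g11 NODE, not here.
-/

noncomputable section
open Finset

namespace Summit.QuantumAdvantage.AdviceFreeQNC0.WindowCounter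

open Summit.QuantumAdvantage.AdviceFreeQNC0

/-! ## §A signs -/

/-- `±1` sign of a Boolean. -/
def sgn (b : Bool) : ℂ := if b then -1 else 1

/-- CharDialWindowCounter helper `sgn_true` (decomp-qadv land package; see the module docstring). -/
@[simp] theorem sgn_true : sgn true = -1 := rfl
/-- CharDialWindowCounterA helper `sgn_false` (decomp-qadv land package; see the module docstring). -/
@[simp] theorem sgn_false : sgn false = 1 := rfl

/-- CharDialWindowCounterA helper `norm_sgn` (decomp-qadv land package; see the module docstring). -/
theorem norm_sgn (b : Bool) : ‖sgn b‖ = 1 := by cases b <;> simp [sgn]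

/-- CharDialWindowCounter helper `sgn_mul_sgn` (decomp-qadv land package; see the module docstring). -/
theorem sgn_mul_sgn (a b : Bool) : sgn a * sgn b = sgn (xor a b) := by
  cases a <;> cases b <;> simp [sgn]

/-- a product of signs is a sign. -/
theorem exists_prod_sgn {L : ℕ} (h : Fin L → Bool) : ∃ b, ∏ j, sgn (h j) = sgn b := by
  induction L with
  | zero => exact ⟨false, by simp⟩
  | succ L ih =>
    obtain ⟨b, hb⟩ := ih (fun j => h j.succ)
    refine ⟨xor (h 0) b, ?_⟩
    rw [Fin.prod_univ_succ, hb, sgn_mul_sgn]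

/-- `‖sgn a + μ³ sgn b‖ ≤ β` when `β` bounds `‖1 ± μ³‖`. -/
theorem norm_sgn_add_le (μ : ℂ) {β : ℝ} (hβ₁ : ‖1 + μ ^ 3‖ ≤ β) (hβ₂ : ‖1 - μ ^ 3‖ ≤ β) (a b : Bool) :
    ‖sgn a + μ ^ 3 * sgn b‖ ≤ β := by
  cases a <;> cases b <;> simp only [sgn_true, sgn_false, mul_one, mul_neg]
  · exact hβ₁
  · rw [← sub_eq_add_neg]; exact hβ₂
  · rw [← norm_neg, neg_add, neg_neg, ← sub_eq_add_neg]; exact hβ₂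
  · rw [← norm_neg, neg_add, neg_neg, neg_neg]; exact hβ₁

/-! ## §B the register transfer

Time runs over bit positions `k`; the REGISTER `r : List Bool` holds the bits already read, most recent first; `P` is
the prefix count (used mod 3).  A sign table `E k r b P` (the sign emitted when bit `b` is read at time `k`) and a
continuation `Φ k r P` are `W`-LOCAL if they depend on `r` only through `r.take W`, and 3-PERIODIC in `P`. -/

section Transfer

variable (μ : ℂ) (E : ℕ → List Bool → Bool → ℕ → Bool)

/-- the register after reading the first `j` bits of `v` on top of `r`. -/
def regAt {m : ℕ} (v : Fin m → Bool) (j : ℕ) (r : List Bool) : List Bool := ((List.ofFn v).take j).reverse ++ r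

/-- CharDialWindowCounter helper `regAt_zero` (decomp-qadv land package; see the module docstring). -/
theorem regAt_zero {m : ℕ} (v : Fin m → Bool) (r : List Bool) : regAt v 0 r = r := by simp [regAt]

/-- CharDialWindowCounter helper `regAt_cons_succ` (decomp-qadv land package; see the module docstring). -/
theorem regAt_cons_succ {m : ℕ} (b : Bool) (v : Fin m → Bool) (j : ℕ) (r : List Bool) :
    regAt (Fin.cons b v : Fin (m + 1) → Bool) (j + 1) r = regAt v j (b :: r) := by
  simp only [regAt, List.ofFn_succ, Fin.cons_zero, Fin.cons_succ, List.take_succ_cons, List.reverse_cons,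
    List.append_assoc, List.singleton_append]

/-- CharDialWindowCounter helper `length_regAt_full` (decomp-qadv land package; see the module docstring). -/
theorem length_regAt_full {m : ℕ} (v : Fin m → Bool) (r : List Bool) :
    regAt v m r = (List.ofFn v).reverse ++ r := by
  simp [regAt]

/-- the top `W` cells after `m ≥ W` pushes do not depend on the old register. -/
theorem take_regAt_full {m W : ℕ} (hW : W ≤ m) (v : Fin m → Bool) (r r' : List Bool) :
    (regAt v m r).take W = (regAt v m r').take W := by
  rw [length_regAt_full, length_regAt_full, List.take_append, List.take_append]
  simp [show W - m = 0 by omega]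

/-- CharDialWindowCounter helper `take_mono` (decomp-qadv land package; see the module docstring). -/
theorem take_mono {W j : ℕ} (hj : j ≤ W) {r r' : List Bool} (h : r.take W = r'.take W) : r.take j = r'.take j := by
  have : ∀ l : List Bool, l.take j = (l.take W).take j := fun l => by rw [List.take_take, min_eq_left hj]
  rw [this r, this r', h]

/-- CharDialWindowCounter helper `take_append_congr` (decomp-qadv land package; see the module docstring). -/
theorem take_append_congr {W : ℕ} (A : List Bool) {r r' : List Bool} (h : r.take W = r'.take W) :
    (A ++ r).take W = (A ++ r').take W := by
  rw [List.take_append, List.take_append, take_mono (Nat.sub_le _ _) h]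

/-- the path sign along `v`, started at time `k` with register `r` and count `P`. -/
def pathSgn {m : ℕ} (k : ℕ) (r : List Bool) (P : ℕ) (v : Fin m → Bool) : ℂ :=
  ∏ j : Fin m, sgn (E (k + j.val) (regAt v j.val r) (v j) (P + wtPrefix v j.val))

/-- CharDialWindowCounter helper `pathSgn_cons` (decomp-qadv land package; see the module docstring). -/
theorem pathSgn_cons {m : ℕ} (k : ℕ) (r : List Bool) (P : ℕ) (b : Bool) (v : Fin m → Bool) :
    pathSgn E k r P (Fin.cons b v : Fin (m + 1) → Bool) = sgn (E k r b P) * pathSgn E (k + 1) (b :: r) (P + b.toNat) v := by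
  unfold pathSgn
  rw [Fin.prod_univ_succ]
  simp only [Fin.cons_zero, Fin.cons_succ, Fin.val_zero, add_zero, regAt_zero, wtPrefix_zero', Fin.val_succ,
    regAt_cons_succ, wtPrefix_cons_succ]
  have e1 : ∀ j : Fin m, k + (j.val + 1) = k + 1 + j.val := fun j => by ring
  have e2 : ∀ x : ℕ, P + (b.toNat + x) = P + b.toNat + x := fun x => by ring
  simp only [e1, e2]

/-- CharDialWindowCounter helper `norm_pathSgn` (decomp-qadv land package; see the module docstring). -/
theorem norm_pathSgn {m : ℕ} (k : ℕ) (r : List Bool) (P : ℕ) (v : Fin m → Bool) : ‖pathSgn E k r P v‖ = 1 := by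
  unfold pathSgn; rw [norm_prod]; simp [norm_sgn]

/-- CharDialWindowCounter helper `exists_pathSgn_eq` (decomp-qadv land package; see the module docstring). -/
theorem exists_pathSgn_eq {m : ℕ} (k : ℕ) (r : List Bool) (P : ℕ) (v : Fin m → Bool) :
    ∃ b, pathSgn E k r P v = sgn b := exists_prod_sgn _

/-- CharDialWindowCounter helper `pathSgn_periodic` (decomp-qadv land package; see the module docstring). -/
theorem pathSgn_periodic (hE : ∀ k r b P, E k r b (P + 3) = E k r b P) {m : ℕ} (k : ℕ) (r : List Bool) (P : ℕ)
    (v : Fin m → Bool) : pathSgn E k r (P + 3) v = pathSgn E k r P v := by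
  unfold pathSgn
  refine prod_congr rfl fun j _ => ?_
  rw [add_right_comm, hE]

/-- CharDialWindowCounter helper `pathSgn_local` (decomp-qadv land package; see the module docstring). -/
theorem pathSgn_local {W : ℕ} (hE : ∀ k ρ ρ' b P, ρ.take W = ρ'.take W → E k ρ b P = E k ρ' b P) {m : ℕ} (k : ℕ)
    {r r' : List Bool} (h : r.take W = r'.take W) (P : ℕ) (v : Fin m → Bool) :
    pathSgn E k r P v = pathSgn E k r' P v := by
  unfold pathSgn
  refine prod_congr rfl fun j _ => ?_
  rw [hE (k + j.val) (regAt v j.val r) (regAt v j.val r') (v j) (P + wtPrefix v j.val)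
    (by unfold regAt; exact take_append_congr _ h)]

/-- the twisted signed path sum with continuation `Φ`: `L` bits from time `k`, register `r`, count `P`. -/
def GG (Φ : ℕ → List Bool → ℕ → ℂ) (L k : ℕ) (r : List Bool) (P : ℕ) : ℂ :=
  ∑ v : Fin L → Bool, μ ^ wt v * pathSgn E k r P v * Φ (k + L) (regAt v L r) (P + wt v)

variable (Φ : ℕ → List Bool → ℕ → ℂ)

/-- CharDialWindowCounter helper `GG_zero` (decomp-qadv land package; see the module docstring). -/
theorem GG_zero (k : ℕ) (r : List Bool) (P : ℕ) : GG μ E Φ 0 k r P = Φ k r P := by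
  simp [GG, pathSgn, regAt, wt]

/-- **recursion**: peel the first bit. -/
theorem GG_succ (L k : ℕ) (r : List Bool) (P : ℕ) :
    GG μ E Φ (L + 1) k r P =
      sgn (E k r false P) * GG μ E Φ L (k + 1) (false :: r) P + μ * sgn (E k r true P) * GG μ E Φ L (k + 1) (true :: r) (P + 1) := by
  unfold GG
  rw [← (Fin.consEquiv fun _ : Fin (L + 1) => Bool).sum_comp, Fintype.sum_prod_type, Fintype.sum_bool]
  simp only [Fin.consEquiv, Equiv.coe_fn_mk, wt_cons, pathSgn_cons, regAt_cons_succ, Bool.toNat_true,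
    Bool.toNat_false, add_zero, mul_sum]
  have e1 : k + (L + 1) = k + 1 + L := by ring
  have e2 : ∀ x : ℕ, P + (1 + x) = P + 1 + x := fun x => by ring
  simp only [e1, e2, pow_add, pow_one]
  rw [add_comm]
  congr 1 <;> refine sum_congr rfl fun w _ => ?_ <;> ring

/-- **composition**: `m + L` bits = `L` bits with continuation «`m` more bits». -/
theorem GG_comp (m L k : ℕ) (r : List Bool) (P : ℕ) :
    GG μ E Φ (m + L) k r P = GG μ E (fun k' r' P' => GG μ E Φ m k' r' P') L k r P := by
  induction L generalizing k r P with
  | zero => rw [GG_zero]; rfl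
  | succ L ih => rw [show m + (L + 1) = m + L + 1 from rfl, GG_succ, GG_succ, ih, ih]

/-- CharDialWindowCounter helper `GG_periodic` (decomp-qadv land package; see the module docstring). -/
theorem GG_periodic (hE : ∀ k r b P, E k r b (P + 3) = E k r b P) (hΦ : ∀ k r P, Φ k r (P + 3) = Φ k r P)
    (L k : ℕ) (r : List Bool) (P : ℕ) : GG μ E Φ L k r (P + 3) = GG μ E Φ L k r P := by
  unfold GG
  refine sum_congr rfl fun v _ => ?_
  rw [pathSgn_periodic E hE, add_right_comm, hΦ]

/-- CharDialWindowCounter helper `GG_local` (decomp-qadv land package; see the module docstring). -/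
theorem GG_local {W : ℕ} (hE : ∀ k ρ ρ' b P, ρ.take W = ρ'.take W → E k ρ b P = E k ρ' b P)
    (hΦ : ∀ k ρ ρ' P, ρ.take W = ρ'.take W → Φ k ρ P = Φ k ρ' P) (L k : ℕ) {r r' : List Bool}
    (h : r.take W = r'.take W) (P : ℕ) : GG μ E Φ L k r P = GG μ E Φ L k r' P := by
  unfold GG
  refine sum_congr rfl fun v _ => ?_
  rw [pathSgn_local E hE k h, hΦ (k + L) (regAt v L r) (regAt v L r') (P + wt v)
    (by unfold regAt; exact take_append_congr _ h)]

/-- the trivial bound: `2^L · M`. -/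
theorem norm_GG_le_basic (hμ : ‖μ‖ = 1) {M : ℝ} (hΦ : ∀ k r P, ‖Φ k r P‖ ≤ M) (L k : ℕ) (r : List Bool) (P : ℕ) :
    ‖GG μ E Φ L k r P‖ ≤ 2 ^ L * M := by
  unfold GG
  refine le_trans (norm_sum_le _ _) ?_
  calc ∑ v : Fin L → Bool, ‖μ ^ wt v * pathSgn E k r P v * Φ (k + L) (regAt v L r) (P + wt v)‖
      ≤ ∑ _v : Fin L → Bool, M := sum_le_sum fun v _ => by
        rw [norm_mul, norm_mul, norm_pow, hμ, one_pow, norm_pathSgn, one_mul, one_mul]; exact hΦ _ _ _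
    _ = 2 ^ L * M := by rw [sum_const, card_univ, Fintype.card_fun, Fintype.card_bool, Fintype.card_fin, nsmul_eq_mul]; push_cast; ring

/-- **THE BLOCK CONTRACTION.**  Over a block of `W + 3` bits the continuations `000·s` and `111·s` land on registers
with the same top `W` cells and on counts differing by `3`, with twist ratio `μ³`; so a `W`-local 3-periodic
continuation bounded by `M` gives `‖GG (W+3)‖ ≤ 2^W (6 + β) M` instead of the trivial `2^{W+3} M`. -/
theorem norm_GG_block_le (hμ : ‖μ‖ = 1) {β : ℝ} (hβ₁ : ‖1 + μ ^ 3‖ ≤ β) (hβ₂ : ‖1 - μ ^ 3‖ ≤ β) {W : ℕ}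
    (hΦl : ∀ k ρ ρ' P, ρ.take W = ρ'.take W → Φ k ρ P = Φ k ρ' P) (hΦp : ∀ k r P, Φ k r (P + 3) = Φ k r P)
    {M : ℝ} (hΦ : ∀ k r P, ‖Φ k r P‖ ≤ M) (k : ℕ) (r : List Bool) (P : ℕ) :
    ‖GG μ E Φ (W + 3) k r P‖ ≤ 2 ^ W * (6 + β) * M := by
  have hM : 0 ≤ M := le_trans (norm_nonneg _) (hΦ 0 [] 0)
  rw [GG_comp]
  set Ψ : ℕ → List Bool → ℕ → ℂ := fun k' r' P' => GG μ E Φ W k' r' P' with hΨ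
  have hΨM : ∀ k r P, ‖Ψ k r P‖ ≤ 2 ^ W * M := fun k r P => norm_GG_le_basic μ E Φ hμ hΦ W k r P
  -- the outer 3-bit sum, split off the two constant continuations
  let x₀ : Fin 3 → Bool := fun _ => false
  let x₁ : Fin 3 → Bool := fun _ => true
  have hx : x₁ ∈ univ.erase x₀ := by
    rw [mem_erase]; exact ⟨fun h => by have := congr_fun h 0; simp [x₀, x₁] at this, mem_univ _⟩
  set T : (Fin 3 → Bool) → ℂ := fun x => μ ^ wt x * pathSgn E k r P x * Ψ (k + 3) (regAt x 3 r) (P + wt x) with hT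
  have hGG : GG μ E Ψ 3 k r P = T x₀ + T x₁ + ∑ x ∈ (univ.erase x₀).erase x₁, T x := by
    unfold GG; rw [← add_sum_erase _ _ (mem_univ x₀), ← add_sum_erase _ _ hx, add_assoc]
  have hcard : ((univ.erase x₀).erase x₁).card = 6 := by
    rw [card_erase_of_mem hx, card_erase_of_mem (mem_univ _), card_univ, Fintype.card_fun, Fintype.card_bool, Fintype.card_fin]; rfl
  -- the six plain terms
  have hplain : ∀ x, ‖T x‖ ≤ 2 ^ W * M := fun x => by
    rw [hT]; dsimp only
    rw [norm_mul, norm_mul, norm_pow, hμ, one_pow, norm_pathSgn, one_mul, one_mul]; exact hΨM _ _ _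
  have hrest : ‖∑ x ∈ (univ.erase x₀).erase x₁, T x‖ ≤ 6 * (2 ^ W * M) := by
    refine le_trans (norm_sum_le _ _) ?_
    calc _ ≤ ∑ _x ∈ (univ.erase x₀).erase x₁, 2 ^ W * M := sum_le_sum fun x _ => hplain x
      _ = 6 * (2 ^ W * M) := by rw [sum_const, hcard, nsmul_eq_mul]; push_cast; ring
  -- the contracting pair
  have hw0 : wt x₀ = 0 := by simp [wt, x₀]
  have hw1 : wt x₁ = 3 := by simp [wt, x₁]
  obtain ⟨a₀, ha₀⟩ := exists_pathSgn_eq E k r P x₀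
  obtain ⟨a₁, ha₁⟩ := exists_pathSgn_eq E k r P x₁
  have hpair : ‖T x₀ + T x₁‖ ≤ β * (2 ^ W * M) := by
    rw [hT]; dsimp only
    rw [hw0, hw1, ha₀, ha₁, pow_zero, one_mul, add_zero, hΨ]
    dsimp only
    unfold GG
    rw [mul_sum, mul_sum, ← sum_add_distrib]
    refine le_trans (norm_sum_le _ _) ?_
    calc ∑ s : Fin W → Bool, ‖sgn a₀ * (μ ^ wt s * pathSgn E (k + 3) (regAt x₀ 3 r) P s *
              Φ (k + 3 + W) (regAt s W (regAt x₀ 3 r)) (P + wt s)) +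
            μ ^ 3 * sgn a₁ * (μ ^ wt s * pathSgn E (k + 3) (regAt x₁ 3 r) (P + 3) s *
              Φ (k + 3 + W) (regAt s W (regAt x₁ 3 r)) (P + 3 + wt s))‖
        ≤ ∑ _s : Fin W → Bool, β * M := sum_le_sum fun s _ => by
          obtain ⟨b₀, hb₀⟩ := exists_pathSgn_eq E (k + 3) (regAt x₀ 3 r) P s
          obtain ⟨b₁, hb₁⟩ := exists_pathSgn_eq E (k + 3) (regAt x₁ 3 r) (P + 3) s
          have eΦ : Φ (k + 3 + W) (regAt s W (regAt x₁ 3 r)) (P + 3 + wt s) =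
              Φ (k + 3 + W) (regAt s W (regAt x₀ 3 r)) (P + wt s) := by
            rw [show P + 3 + wt s = P + wt s + 3 by ring, hΦp,
              hΦl _ _ (regAt s W (regAt x₀ 3 r)) _ (take_regAt_full le_rfl s _ _)]
          rw [hb₀, hb₁, eΦ]
          have : sgn a₀ * (μ ^ wt s * sgn b₀ * Φ (k + 3 + W) (regAt s W (regAt x₀ 3 r)) (P + wt s)) +
              μ ^ 3 * sgn a₁ * (μ ^ wt s * sgn b₁ * Φ (k + 3 + W) (regAt s W (regAt x₀ 3 r)) (P + wt s)) =
              μ ^ wt s * (sgn (xor a₀ b₀) + μ ^ 3 * sgn (xor a₁ b₁)) *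
                Φ (k + 3 + W) (regAt s W (regAt x₀ 3 r)) (P + wt s) := by
            rw [← sgn_mul_sgn, ← sgn_mul_sgn]; ring
          rw [this, norm_mul, norm_mul, norm_pow, hμ, one_pow, one_mul]
          exact mul_le_mul (norm_sgn_add_le μ hβ₁ hβ₂ _ _) (hΦ _ _ _) (norm_nonneg _)
            (le_trans (norm_nonneg _) hβ₁)
      _ = β * (2 ^ W * M) := by rw [sum_const, card_univ, Fintype.card_fun, Fintype.card_bool, Fintype.card_fin, nsmul_eq_mul]; push_cast; ring
  rw [hGG]
  calc _ ≤ β * (2 ^ W * M) + 6 * (2 ^ W * M) := norm_add_le_of_le hpair hrest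
    _ = 2 ^ W * (6 + β) * M := by ring

/-- **uniform geometric bound**: `‖GG (q (W+3) + j)‖ ≤ 2^j (2^W (6+β))^q` for a `W`-local 3-periodic unit
continuation and a `W`-local 3-periodic sign table. -/
theorem norm_GG_iter (hμ : ‖μ‖ = 1) {β : ℝ} (hβ₁ : ‖1 + μ ^ 3‖ ≤ β) (hβ₂ : ‖1 - μ ^ 3‖ ≤ β) {W : ℕ}
    (hEl : ∀ k ρ ρ' b P, ρ.take W = ρ'.take W → E k ρ b P = E k ρ' b P) (hEp : ∀ k r b P, E k r b (P + 3) = E k r b P)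
    (hΦl : ∀ k ρ ρ' P, ρ.take W = ρ'.take W → Φ k ρ P = Φ k ρ' P) (hΦp : ∀ k r P, Φ k r (P + 3) = Φ k r P)
    (hΦ1 : ∀ k r P, ‖Φ k r P‖ ≤ 1) :
    ∀ q j k r P, ‖GG μ E Φ (q * (W + 3) + j) k r P‖ ≤ 2 ^ j * (2 ^ W * (6 + β)) ^ q := by
  intro q
  induction q with
  | zero =>
    intro j k r P
    simpa using norm_GG_le_basic μ E Φ hμ hΦ1 j k r P
  | succ q ih =>
    intro j k r P
    rw [show (q + 1) * (W + 3) + j = (q * (W + 3) + j) + (W + 3) by ring, GG_comp]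
    have := norm_GG_block_le μ E (fun k' r' P' => GG μ E Φ (q * (W + 3) + j) k' r' P') hμ hβ₁ hβ₂ (W := W)
      (fun k ρ ρ' P h => GG_local μ E Φ hEl hΦl _ _ h _) (fun k r P => GG_periodic μ E Φ hEp hΦp _ _ _ _)
      (fun k r P => ih j k r P) k r P
    calc _ ≤ 2 ^ W * (6 + β) * (2 ^ j * (2 ^ W * (6 + β)) ^ q) := this
      _ = 2 ^ j * (2 ^ W * (6 + β)) ^ (q + 1) := by ring

/-- the bound in closed form: `‖GG n‖ ≤ 2ⁿ κ^{⌊n/(W+3)⌋}` with `κ = (6+β)/8`. -/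
theorem norm_GG_le_kappa (hμ : ‖μ‖ = 1) {β : ℝ} (hβ₁ : ‖1 + μ ^ 3‖ ≤ β) (hβ₂ : ‖1 - μ ^ 3‖ ≤ β) {W : ℕ}
    (hEl : ∀ k ρ ρ' b P, ρ.take W = ρ'.take W → E k ρ b P = E k ρ' b P) (hEp : ∀ k r b P, E k r b (P + 3) = E k r b P)
    (hΦl : ∀ k ρ ρ' P, ρ.take W = ρ'.take W → Φ k ρ P = Φ k ρ' P) (hΦp : ∀ k r P, Φ k r (P + 3) = Φ k r P)
    (hΦ1 : ∀ k r P, ‖Φ k r P‖ ≤ 1) (n k : ℕ) (r : List Bool) (P : ℕ) :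
    ‖GG μ E Φ n k r P‖ ≤ 2 ^ n * ((6 + β) / 8) ^ (n / (W + 3)) := by
  have h := norm_GG_iter μ E Φ hμ hβ₁ hβ₂ hEl hEp hΦl hΦp hΦ1 (n / (W + 3)) (n % (W + 3)) k r P
  rw [Nat.div_add_mod'] at h
  set q := n / (W + 3) with hq
  set j := n % (W + 3) with hj
  have hn : j + (W + 3) * q = n := Nat.mod_add_div n (W + 3)
  have e : (2 : ℝ) ^ n = 2 ^ j * (2 ^ W * 8) ^ q := by
    rw [← hn, pow_add, pow_mul, pow_add]; norm_num
  calc _ ≤ 2 ^ j * (2 ^ W * (6 + β)) ^ q := h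
    _ = 2 ^ n * ((6 + β) / 8) ^ q := by
        rw [e, mul_assoc, ← mul_pow]
        congr 2
        ring

end Transfer


end Summit.QuantumAdvantage.AdviceFreeQNC0.WindowCounter
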